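import Summits.QuantumFields.YangMills.Theorems.BalabanLadderROTSingleAngle
import HarnessLib

/-!
# Crux `ROT` (stmt-QuantumFields-20042): the hierarchy of King inputs — `KingAll ⇒ KingLimit ⇔ KingSingle ⇔ ROT⁻ ⇒ ROT`

Helper file (`--supports stmt-QuantumFields-20042`) of the fleet lead `ym-spine-20042-p1`, line of record «King split» (skeleton v3
`Cruxes/ROT/Lines/birth.lean`, ff3050db3a1215f0; vocabulary `Theorems/BalabanLadderROTDefs.lean` §1–§3).  With `stub_uvExtract` PROVED
(`…ROTUVExtract.lean`), the King side (`…ROTOfKing.lean`, `…ROTSingleAngle.lean`) gives kernel-checked closers for three texts of the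
King input; this file records their logical order as theorems over the bare identifiers of the Defs file, so that whichever text the
owner registers as v4's `stub_king`, the composition `ROT_of` is one line:

* `latticeKingWard_mono` — KING is antitone in the angle set;
* `kingSingle_of_kingAll`, `kingLimit_of_kingAll` — the registered v3 text `KingAll` implies both UV-guarded texts;
* `kingSingle_of_kingLimit`, `kingLimit_of_kingSingle`, `kingLimit_iff_kingSingle` — the two UV-guarded texts are EQUIVALENT
  (compactness by `stub_uvExtract`; `⇐` through `LatticeRotWard` and `limitsInvariant_of_latticeRotWard`);
* `kingSingle_iff_rotUV` — `KingSingle` is, VERBATIM up to King's one-angle form, the crux `ROT` with its idle `LowerBounds` guard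
  dropped («`ROT⁻`», spelled out, no definition);
* `rot_of_stub_kingLimit : KingLimit → ROT`, `rot_of_stub_kingSingle : KingSingle → ROT` — the closers by name over the
  Defs identifiers (for `KingAll` the closer is `rot_of_kingAll` of `…ROTOfKing.lean`).

No new definition, no named fact, no sorry; standard axioms.  NOT a proof of E1.
-/

set_option autoImplicit false

noncomputable section

open scoped SchwartzMap
open MeasureTheory Filter Topology Real
open Literature.MathematicalPhysics.QuantumFieldTheory Literature.MathematicalPhysics.QuantumLattice
open Literature.MathematicalPhysics.AQFT Literature.Probability.LatticeModels
open Summit.QuantumFields.YangMills.Cruxes.OSLegsFromFemtoAndGap.DlrCollarTransfer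
open Summit.QuantumFields.YangMills.Cruxes.OSLegsAtWeakCouplingC.Sketch
open Summit.QuantumFields.YangMills.Cruxes.OSLegsAtWeakCouplingC.Y2Bridge
open Summit.QuantumFields.YangMills.Theorems.OSLegsFromFemtoAndGap (latticeDist)
open Summit.QuantumFields.YangMills.Theorems.NPointIsotropy.Negative (E4)

namespace Summit.QuantumFields.YangMills.Theorems.ROT

section Mono

variable {G : Type} [Group G] [TopologicalSpace G] [IsTopologicalGroup G] [CompactSpace G]
  [MeasurableSpace G] [BorelSpace G]

/-- **KING is antitone in the angle set**: fewer angles, weaker statement (same germ radius). [folklore] -/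
theorem latticeKingWard_mono (r : LatticeRep G) (a : ℝ → ℝ) {Θ Θ' : Set ℝ} (h : Θ' ⊆ Θ)
    (hK : LatticeKingWard G r a Θ) : LatticeKingWard G r a Θ' := by
  intro sch hunits hβ hranges
  obtain ⟨r₀, hr₀, hKs⟩ := hK sch hunits hβ hranges
  exact ⟨r₀, hr₀, fun n hn F hF θ hθ => hKs n hn F hF θ (h hθ)⟩

end Mono

/-! ## `KingAll` implies the UV-guarded texts -/

/-- `KingAll → KingSingle`: King's angle `arcsin (3/5)` is Pythagorean (tree `King.arcsin_three_fifths_mem`), and the UV guard is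
simply not used. [folklore] -/
theorem kingSingle_of_kingAll (h : KingAll) : KingSingle := by
  intro G _ _ _ _ hG
  letI : MeasurableSpace G := borel G
  haveI : BorelSpace G := ⟨rfl⟩
  intro r a ha ha0 _
  exact latticeKingWard_mono r a (Set.singleton_subset_iff.2 King.arcsin_three_fifths_mem) (h G hG r a ha ha0)

/-- `KingAll → KingLimit`: lattice KING at the Pythagorean angles gives King-invariance of every off-diagonal limit point
(`limitsKingInvariant_of_latticeKingWard`, uniqueness of limits); the UV guard is not used. [folklore] -/
theorem kingLimit_of_kingAll (h : KingAll) : KingLimit := by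
  intro G _ _ _ _ hG
  letI : MeasurableSpace G := borel G
  haveI : BorelSpace G := ⟨rfl⟩
  intro r a ha ha0 _ sch hsch
  exact limitsKingInvariant_of_latticeKingWard r a _ (h G hG r a ha ha0) sch hsch

/-! ## The two UV-guarded texts are equivalent -/

/-- `KingLimit → KingSingle`: King-invariance of the limit points at all Pythagorean angles, restricted to King's one angle, gives the
lattice statement there by the sub-subsequence argument (compactness from the PROVED `stub_uvExtract`). [folklore] -/
theorem kingSingle_of_kingLimit (h : KingLimit) : KingSingle := by
  intro G _ _ _ _ hG
  letI : MeasurableSpace G := borel G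
  haveI : BorelSpace G := ⟨rfl⟩
  intro r a ha ha0 hMB
  refine latticeKingWard_of_uvCompactAt_of_limitsKingInvariant r a (stub_uvExtract G hG r a ha ha0 hMB) _ fun sch hsch => ?_
  obtain ⟨r₀, hr₀, H⟩ := h G hG r a ha ha0 hMB sch hsch
  exact ⟨r₀, hr₀, fun φ hφ S₁ hS₁ n hn F hF θ hθ =>
    H φ hφ S₁ hS₁ n hn F hF θ (by rw [Set.mem_singleton_iff.1 hθ]; exact King.arcsin_three_fifths_mem)⟩

/-- `KingSingle → KingLimit`: KING at one irrational-over-`2π` angle gives `LatticeRotWard` (single-angle upgrade, compactness from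
`stub_uvExtract`), whose limit points are invariant under EVERY plane rotation (`limitsInvariant_of_latticeRotWard`). [folklore] -/
theorem kingLimit_of_kingSingle (h : KingSingle) : KingLimit := by
  intro G _ _ _ _ hG
  letI : MeasurableSpace G := borel G
  haveI : BorelSpace G := ⟨rfl⟩
  intro r a ha ha0 hMB sch hsch
  have hR : LatticeRotWard G r a :=
    latticeRotWard_of_uvCompactAt_of_latticeKingWard_single r a (stub_uvExtract G hG r a ha ha0 hMB)
      irrational_arcsin_three_fifths_div_two_pi (h G hG r a ha ha0 hMB)
  obtain ⟨r₀, hr₀, H⟩ := limitsInvariant_of_latticeRotWard r a hR sch hsch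
  exact ⟨r₀, hr₀, fun φ hφ S₁ hS₁ n hn F hF θ _ => H φ hφ S₁ hS₁ n hn F hF θ⟩

/-- **`KingLimit ↔ KingSingle`.** [folklore] -/
theorem kingLimit_iff_kingSingle : KingLimit ↔ KingSingle :=
  ⟨kingSingle_of_kingLimit, kingLimit_of_kingSingle⟩

/-! ## `KingSingle` is the crux without its idle `LowerBounds` guard, in King's one-angle form -/

/-- **`KingSingle ↔ ROT⁻`** (the crux `ROT` with the `LowerBounds` guard dropped, spelled out): in `MomentBounds6` units King's
single-angle lattice Ward statement and `LatticeRotWard` are equivalent (`latticeKingWard_single_iff_latticeRotWard_of_momentBounds6`).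
[C. King, CMP 103 (1986) Thm 2.4 — mechanism; folklore converse] -/
theorem kingSingle_iff_rotUV :
    KingSingle ↔
      ∀ (G : Type) [Group G] [TopologicalSpace G] [IsTopologicalGroup G] [CompactSpace G],
        IsCompactSimpleLieGroup G → letI : MeasurableSpace G := borel G; haveI : BorelSpace G := ⟨rfl⟩;
        ∀ (r : LatticeRep G) (a : ℝ → ℝ), (∀ β, 0 < a β) → Tendsto a atTop (𝓝 0) → MomentBounds6 G r a →
          LatticeRotWard G r a := by
  constructor
  · intro h G _ _ _ _ hG
    letI : MeasurableSpace G := borel G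
    haveI : BorelSpace G := ⟨rfl⟩
    intro r a ha ha0 hMB
    exact (latticeKingWard_single_iff_latticeRotWard_of_momentBounds6 G hG r a ha ha0 hMB).1 (h G hG r a ha ha0 hMB)
  · intro h G _ _ _ _ hG
    letI : MeasurableSpace G := borel G
    haveI : BorelSpace G := ⟨rfl⟩
    intro r a ha ha0 hMB
    exact (latticeKingWard_single_iff_latticeRotWard_of_momentBounds6 G hG r a ha ha0 hMB).2 (h G hG r a ha ha0 hMB)

/-! ## The closers, by name over the Defs identifiers -/

/-- **`KingSingle → ROT`** (closer for a v4 `stub_king : KingSingle`). [C. King, CMP 103 (1986) Thm 2.4 — mechanism] -/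
theorem rot_of_stub_kingSingle (h : KingSingle) : Summit.QuantumFields.YangMills.Theses.BalabanLadder.ROT :=
  rot_of_kingSingle h

/-- **`KingLimit → ROT`** (closer for a v4 `stub_king : KingLimit`). [C. King, CMP 103 (1986) Thm 2.4 — mechanism] -/
theorem rot_of_stub_kingLimit (h : KingLimit) : Summit.QuantumFields.YangMills.Theses.BalabanLadder.ROT :=
  rot_of_kingLimit h

end Summit.QuantumFields.YangMills.Theorems.ROT

end
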